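import Literature.Analysis.Convexity.KestenRatioScheme
import Literature.Computability.Complexity.RandomKSatPairPolyNearOne
import HarnessLib

/-!
# An explicit supersolution of Kesten's contraction recursion that is close to `1`

For the recursion of `kesten_multilevel_osc_le` — `K/(1-ε)² ≤ Q 1`,
`(1/K + (1 - 1/K) Q l)/(1-ε)² ≤ Q (l+1)` — we exhibit, for every cross-ratio constant `K ≥ 1` and every
target `θ ∈ (0, 1]`, a number of levels `L` and a junk threshold `ε₀ > 0` such that for every junk rate
`ε ∈ [0, ε₀]` some supersolution satisfies `Q L ≤ 1 + θ`: the affine recursion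
`x ↦ s/K + s r x` (`s = (1-ε)⁻²`, `r = 1 - 1/K`) is solved in closed form,
`Q l = x⋆ + (s r)^(l-1) (s K - x⋆)` with fixed point `x⋆ = (s/K)/(1 - s r) → 1` as `ε → 0`, and the
geometric term is killed by taking `L` large FIRST (depending on `K, θ` only) and then `ε` small
(the elementary bound `(1+x)^n ≤ 1/(1-nx)` is the tree's `RandomKSat.one_add_pow_le_one_div`).
[cite: Kesten1986, §2, eqs. (24)–(25)]
-/

open Finset

namespace Literature.Analysis.Convexity.Doeblin

/-- **A supersolution of Kesten's contraction recursion close to `1`.** For `K ≥ 1` and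
`0 < θ ≤ 1` there are `L ≥ 1` and `ε₀ > 0` such that for every `ε ∈ [0, ε₀]` some `Q : ℕ → ℝ`
satisfies `K/(1-ε)² ≤ Q 1`, `(1/K + (1 - 1/K) Q l)/(1-ε)² ≤ Q (l+1)` for `1 ≤ l < L`, and
`Q L ≤ 1 + θ` (closed-form solution of the affine recursion; `L` is chosen with
`(1 - 1/K)^(L-1) ≤ θ/(8K)`, then `ε ≤ θ/(64 K L)`). [cite: Kesten1986, §2, eqs. (24)–(25)] -/
theorem exists_supersolution_le {K θ : ℝ} (hK : 1 ≤ K) (hθ : 0 < θ) (hθ1 : θ ≤ 1) :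
    ∃ L : ℕ, 1 ≤ L ∧ ∃ ε₀ : ℝ, 0 < ε₀ ∧ ∀ ε : ℝ, 0 ≤ ε → ε ≤ ε₀ →
      ∃ Q : ℕ → ℝ, K / (1 - ε) ^ 2 ≤ Q 1 ∧
        (∀ l : ℕ, 1 ≤ l → l < L → (1 / K + (1 - 1 / K) * Q l) / (1 - ε) ^ 2 ≤ Q (l + 1)) ∧
        Q L ≤ 1 + θ := by
  have hK0 : 0 < K := one_pos.trans_le hK
  have hiK : 0 < 1 / K := by positivity
  have hiK1 : 1 / K ≤ 1 := (div_le_one hK0).2 hK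
  set r : ℝ := 1 - 1 / K with hr
  have hr0 : 0 ≤ r := by rw [hr]; linarith
  have hr1 : r < 1 := by rw [hr]; linarith
  -- (1) `L = N + 1` with `r^N ≤ θ/(8K)`
  obtain ⟨N, hN⟩ : ∃ N : ℕ, r ^ N ≤ θ / (8 * K) := by
    obtain ⟨N, hN⟩ := exists_pow_lt_of_lt_one (show 0 < θ / (8 * K) by positivity) hr1
    exact ⟨N, hN.le⟩
  have hNpos : (0 : ℝ) < N + 1 := by positivity
  have hN1 : (1 : ℝ) ≤ N + 1 := by
    have : (0 : ℝ) ≤ N := Nat.cast_nonneg N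
    linarith
  refine ⟨N + 1, by omega, θ / (64 * K * (N + 1)), by positivity, fun ε hε0 hεle => ?_⟩
  -- (2) elementary bounds on `ε` and on `s = (1-ε)⁻²`
  have hεK : K * ε ≤ θ / 64 := by
    have h1 : K * ε ≤ K * (θ / (64 * K * (N + 1))) := mul_le_mul_of_nonneg_left hεle hK0.le
    have h2 : K * (θ / (64 * K * (N + 1))) = θ / 64 / (N + 1) := by
      field_simp
    rw [h2] at h1
    exact h1.trans (div_le_self (by positivity) hN1)
  have hεN : (N + 1 : ℝ) * ε ≤ θ / 64 := by
    have h1 : (N + 1 : ℝ) * ε ≤ (N + 1) * (θ / (64 * K * (N + 1))) :=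
      mul_le_mul_of_nonneg_left hεle hNpos.le
    have h2 : (N + 1 : ℝ) * (θ / (64 * K * (N + 1))) = θ / 64 / K := by
      field_simp
    rw [h2] at h1
    exact h1.trans (div_le_self (by positivity) hK)
  have hε_small : ε ≤ 1 / 64 := by
    have : K * ε ≥ 1 * ε := mul_le_mul_of_nonneg_right hK hε0
    linarith
  have h1ε : 0 < 1 - ε := by linarith
  set s : ℝ := 1 / (1 - ε) ^ 2 with hs
  have hs1 : 1 ≤ s := by
    rw [hs, le_div_iff₀ (pow_pos h1ε 2), one_mul]
    nlinarith
  have hs0 : 0 < s := one_pos.trans_le hs1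
  have hs_le : s ≤ 1 + 4 * ε := by
    rw [hs, div_le_iff₀ (pow_pos h1ε 2)]
    nlinarith [hε0, hε_small, sq_nonneg ε, mul_nonneg hε0 (sq_nonneg ε)]
  -- (3) the fixed point `x = (s/K)/(1 - s r)` and its bound `x ≤ 1 + θ/2`
  have hsr_id : 1 - s * r = s / K - (s - 1) := by rw [hr]; ring
  have h1sr : (15 / 16) / K ≤ 1 - s * r := by
    rw [hsr_id]
    have h2 : 1 / K ≤ s / K := div_le_div_of_nonneg_right hs1 hK0.le
    have h3 : s - 1 ≤ 4 * ε := by linarith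
    have h4 : 4 * ε ≤ (1 / 16) / K := by
      rw [le_div_iff₀ hK0]
      nlinarith [hεK, hθ1]
    have h5 : (15 / 16) / K = 1 / K - (1 / 16) / K := by ring
    linarith
  have h1sr0 : 0 < 1 - s * r := lt_of_lt_of_le (by positivity) h1sr
  have hsr : 0 ≤ s * r := mul_nonneg hs0.le hr0
  have hsr1 : s * r < 1 := by linarith
  set x : ℝ := (s / K) / (1 - s * r) with hx
  have hx0 : 0 < x := by rw [hx]; positivity
  have hx_mul : x * (1 - s * r) = s / K := by rw [hx]; field_simp
  have hfix : s / K + s * r * x = x := by linear_combination (-1 : ℝ) * hx_mul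
  have hx_le : x ≤ 1 + θ / 2 := by
    -- `x - 1 = (s - 1)/(1 - s r) ≤ 4ε · 16K/15 ≤ θ/15`
    have h1 : (x - 1) * (1 - s * r) = s - 1 := by
      have : (x - 1) * (1 - s * r) = x * (1 - s * r) - (1 - s * r) := by ring
      rw [this, hx_mul, hsr_id]; ring
    have h2 : (x - 1) * (1 - s * r) ≤ 4 * ε := by rw [h1]; linarith
    have h3 : x - 1 ≤ 4 * ε / (1 - s * r) := by rw [le_div_iff₀ h1sr0]; exact h2
    have h4 : 4 * ε / (1 - s * r) ≤ 4 * ε / ((15 / 16) / K) :=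
      div_le_div_of_nonneg_left (by positivity) (by positivity) h1sr
    have h5 : 4 * ε / ((15 / 16) / K) = (64 / 15) * (K * ε) := by
      field_simp
      ring
    linarith [hεK, hθ]
  -- (4) closed form `Q l = x + (s r)^(l-1) (s K - x)`
  set Q : ℕ → ℝ := fun l => x + (s * r) ^ (l - 1) * (s * K - x) with hQ
  have hQ1 : Q 1 = s * K := by simp [hQ]
  have hstep : ∀ l : ℕ, 1 ≤ l → Q (l + 1) = s / K + s * r * Q l := by
    intro l hl
    obtain ⟨k, rfl⟩ := Nat.exists_eq_add_of_le hl
    simp only [hQ, Nat.add_sub_cancel_left, show 1 + k + 1 - 1 = k + 1 by omega, pow_succ]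
    linear_combination (-1 : ℝ) * hfix
  refine ⟨Q, ?_, ?_, ?_⟩
  · rw [hQ1, hs]; exact le_of_eq (by ring)
  · intro l hl _
    rw [hstep l hl, hs, hr]
    exact le_of_eq (by ring)
  · -- `Q (N+1) = x + (s r)^N (s K - x) ≤ (1 + θ/2) + s^(N+1) r^N K ≤ 1 + θ/2 + 2 (θ/8)`
    have hQN : Q (N + 1) = x + (s * r) ^ N * (s * K - x) := by
      simp only [hQ, Nat.add_sub_cancel]
    rw [hQN]
    have hsK : s * K - x ≤ s * K := by linarith
    have hcast : ((N + 1 : ℕ) : ℝ) = (N : ℝ) + 1 := by push_cast; ring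
    have h4ε : ((N : ℝ) + 1) * (4 * ε) ≤ 1 / 16 := by
      have : ((N : ℝ) + 1) * (4 * ε) = 4 * ((N + 1) * ε) := by ring
      rw [this]
      linarith [hεN, hθ1]
    have hsN : s ^ (N + 1) ≤ 2 := by
      have h1 : s ^ (N + 1) ≤ (1 + 4 * ε) ^ (N + 1) := pow_le_pow_left₀ hs0.le hs_le _
      have h2 : ((N + 1 : ℕ) : ℝ) * (4 * ε) < 1 := by rw [hcast]; linarith
      have h3 := Literature.Computability.Complexity.RandomKSat.one_add_pow_le_one_div (n := N + 1)
        (by linarith) (by linarith) h2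
      have h4 : 1 / (1 - ((N + 1 : ℕ) : ℝ) * (4 * ε)) ≤ 2 := by
        rw [hcast, div_le_iff₀ (by linarith)]
        linarith
      exact h1.trans (h3.trans h4)
    have hrK : r ^ N * K ≤ θ / 8 := by
      have := mul_le_mul_of_nonneg_right hN hK0.le
      have h' : θ / (8 * K) * K = θ / 8 := by field_simp
      linarith [h'.symm.le, this]
    have hgeo : (s * r) ^ N * (s * K - x) ≤ θ / 4 :=
      calc (s * r) ^ N * (s * K - x) ≤ (s * r) ^ N * (s * K) :=
            mul_le_mul_of_nonneg_left hsK (pow_nonneg hsr N)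
        _ = s ^ (N + 1) * (r ^ N * K) := by rw [mul_pow]; ring
        _ ≤ 2 * (r ^ N * K) := mul_le_mul_of_nonneg_right hsN (by positivity)
        _ ≤ 2 * (θ / 8) := mul_le_mul_of_nonneg_left hrK (by norm_num)
        _ = θ / 4 := by ring
    linarith

end Literature.Analysis.Convexity.Doeblin
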